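import Literature.Analysis.FluidPDE.NSBoundedMildOseenDuhamel
import Literature.Analysis.FluidPDE.KNSSRemark61
import Literature.Analysis.UnboundedOperators.HeatKernelBoundedData
import Mathlib.MeasureTheory.Integral.Average
import HarnessLib

/-!
# Conservation of momentum at spatial infinity for the Oseen integral equation (ball averages)

Topic: Analysis/FluidPDE (next to `NSBoundedMildOseenDuhamel`, `KNSSRemark61`). All results
proved; no definitions, no named facts. For a bounded field the two terms of the Oseen integral
equation `V(t) = e^{(t−s)Δ}V(s) − B¹_s(V,V)(t)` of Koch–Nadirashvili–Seregin–Šverák 2009, §4 (i)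
(`UnboundedOperators.heatExtension`, `oseenDuhamel`) do not move the mean at spatial infinity:
in dimension `3`, with `B_R = ball 0 R`,

* `tendsto_setAverage_heatExtension_sub`: `⨍_{B_R} (e^{τΔ}g − g) → 0` as `R → ∞` for `g`
  measurable and bounded, `τ > 0`;
* `tendsto_setAverage_oseenDuhamel`: `⨍_{B_R} B¹_s(V,V)(t) → 0` as `R → ∞` for `V` jointly
  measurable and bounded on `[s, t] × E`, `s < t`.

Hence a bounded Oseen-mild field has `⨍_{B_R} (V(t) − V(s)) → 0` (KNSS 2009, §4: `B` involves
only spatial derivatives of `u ⊗ u`; the parasitic solutions `b(t)` of §1 are exactly what this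
rules in or out).

## Proof

Everything rests on the `L¹` translation modulus of the indicator `χ_R = 1_{B_R}`:
`∫ |χ_R(u + z) − χ_R(u)| du ≤ min(2, 8‖z‖/R) |B_R|` (`lintegral_enorm_indicator_ball_add_sub_le`:
the integrand lives on the annulus `B_{R+‖z‖} \ B_{R−‖z‖}`, of volume
`((R+r)³ − (R−r)³)|B_1| ≤ 8 r R² |B_1|` for `r ≤ R`).

* Heat part. By Fubini, `∫_{B_R} (e^{τΔ}g − g) = ∫ Φ_τ(y) (∫_{B_R} (g(· − y) − g)) dy`
  (`∫ Φ_τ = 1`), and `‖∫_{B_R} (g(· − y) − g)‖ ≤ M ∫ |χ_R(u + y) − χ_R(u)| du` for `‖g‖ ≤ M`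
  (`enorm_setIntegral_ball_comp_sub_sub_le`); dominated convergence against the heat kernel.
* Oseen part. By Fubini over `B_R × ((s,t) × E)` (absolute convergence of the Duhamel term of
  bounded fields, `exists_lintegral_enorm_oseenKernel_bounded_le`),
  `∫_{B_R} B¹_s(V,V)(t) = ∫_{(τ,y)} ∫_{x ∈ B_R} K(t−τ, x−y)[V(τ,y), V(τ,y)] dx`, and since the Oseen
  kernel has integral zero (`integral_oseenKernel_eq_zero`, oddness),
  `∫_{x∈B_R} K(σ, x−y)[a,a] dx = ∫ (χ_R(x) − χ_R(y)) K(σ, x−y)[a,a] dx`, of norm at most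
  `C N² ∫ |χ_R(z+y) − χ_R(y)| (σ + ‖z‖²)^{-2} dz` (Koch–Tataru's bound (14),
  `exists_norm_oseenKernel_le`; `enorm_setIntegral_oseenKernel_le`). Integrating in `y`
  (Tonelli, `lintegral_lintegral_indicator_weight_le`) and `τ` gives
  `‖⨍_{B_R} B‖ ≤ C N² ∫_{(s,t)} ∫ ((t−τ) + ‖z‖²)^{-2} min(2, 8‖z‖/R) dz dτ → 0` by dominated
  convergence (`∫ ((t−τ) + ‖z‖²)^{-2} dz = (t−τ)^{-1/2} ∫ (1 + ‖w‖²)^{-2} dw`, integrable on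
  `(s,t)`; `tendsto_lintegral_Ioo_lintegral_weight`).

## References

* G. Koch, N. Nadirashvili, G. Seregin, V. Šverák, *Liouville theorems for the Navier–Stokes
  equations and applications*, Acta Math. 203 (2009) 83–105 = arXiv:0709.3599, §1 p. 3
  (parasitic solutions), §4 p. 8 (the bilinear form `B`, mild bounded ancient solutions).
  [KochNadirashviliSereginSverak2009]
* H. Koch, D. Tataru, *Well-posedness for the Navier–Stokes equations*, Adv. Math. 157 (2001),
  §2 (8), §3 (14). [KochTataruAdvMath2001]
-/

noncomputable section

open MeasureTheory Filter Set Function Metric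
open scoped Topology ENNReal

namespace Literature.Analysis.FluidPDE


variable {E : Type*} [NormedAddCommGroup E] [InnerProductSpace ℝ E] [FiniteDimensional ℝ E]
  [MeasurableSpace E] [BorelSpace E]

/-! ### The `L¹` translation modulus of the indicator of a ball -/

omit [InnerProductSpace ℝ E] [FiniteDimensional ℝ E] [MeasurableSpace E] [BorelSpace E] in
/-- The translate of the indicator of `B_R` by `z` differs from it only on the annulus
`B_{R+‖z‖} \ B_{R−‖z‖}`. [folklore] -/
theorem enorm_indicator_ball_add_sub_le (R : ℝ) (z u : E) :
    ‖(ball (0 : E) R).indicator (fun _ => (1 : ℝ)) (u + z) -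
        (ball (0 : E) R).indicator (fun _ => (1 : ℝ)) u‖ₑ ≤
      (ball (0 : E) (R + ‖z‖) \ ball 0 (R - ‖z‖)).indicator 1 u := by
  have huz : ‖u‖ ≤ ‖u + z‖ + ‖z‖ := by
    calc ‖u‖ = ‖(u + z) - z‖ := by rw [add_sub_cancel_right]
      _ ≤ ‖u + z‖ + ‖z‖ := norm_sub_le _ _
  have hzu : ‖u + z‖ ≤ ‖u‖ + ‖z‖ := norm_add_le _ _
  by_cases h1 : u + z ∈ ball (0 : E) R <;> by_cases h2 : u ∈ ball (0 : E) R <;>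
    simp only [indicator_of_mem, indicator_of_notMem, h1, h2, not_false_eq_true, sub_self,
      enorm_zero, zero_le, sub_zero, zero_sub, enorm_neg] <;>
    rw [mem_ball_zero_iff] at h1 h2
  · have hu : u ∈ ball (0 : E) (R + ‖z‖) \ ball 0 (R - ‖z‖) :=
      ⟨mem_ball_zero_iff.2 (by linarith), fun h => h2 (by rw [mem_ball_zero_iff] at h; linarith)⟩
    simp [indicator_of_mem hu]
  · have hu : u ∈ ball (0 : E) (R + ‖z‖) \ ball 0 (R - ‖z‖) :=
      ⟨mem_ball_zero_iff.2 (by linarith [norm_nonneg z]),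
        fun h => h1 (by rw [mem_ball_zero_iff] at h; linarith)⟩
    simp [indicator_of_mem hu]

/-- **`L¹` translation modulus of `1_{B_R}` in dimension `3`**:
`∫ |1_{B_R}(u + z) − 1_{B_R}(u)| du ≤ min(2, 8‖z‖/R) |B_R|` for `R > 0` (the annulus
`B_{R+r} \ B_{R−r}` has volume `((R+r)³ − (R−r)³)|B_1| ≤ 8 r R²|B_1|` for `r ≤ R`). [folklore] -/
theorem lintegral_enorm_indicator_ball_add_sub_le (hd : Module.finrank ℝ E = 3) {R : ℝ}
    (hR : 0 < R) (z : E) :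
    ∫⁻ u, ‖(ball (0 : E) R).indicator (fun _ => (1 : ℝ)) (u + z) -
        (ball (0 : E) R).indicator (fun _ => (1 : ℝ)) u‖ₑ ≤
      ENNReal.ofReal (min 2 (8 * ‖z‖ / R)) * volume (ball (0 : E) R) := by
  have hχm : Measurable ((ball (0 : E) R).indicator (fun _ => (1 : ℝ))) :=
    measurable_const.indicator measurableSet_ball
  have hone :
      ∫⁻ u, ‖(ball (0 : E) R).indicator (fun _ => (1 : ℝ)) u‖ₑ = volume (ball (0 : E) R) := by
    simp [enorm_indicator_eq_indicator_enorm, lintegral_indicator, measurableSet_ball]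
  rcases min_cases (2 : ℝ) (8 * ‖z‖ / R) with ⟨hmin, -⟩ | ⟨hmin, hle⟩ <;> rw [hmin]
  · calc ∫⁻ u, ‖(ball (0 : E) R).indicator (fun _ => (1 : ℝ)) (u + z) -
            (ball (0 : E) R).indicator (fun _ => (1 : ℝ)) u‖ₑ
        ≤ ∫⁻ u, (‖(ball (0 : E) R).indicator (fun _ => (1 : ℝ)) (u + z)‖ₑ +
            ‖(ball (0 : E) R).indicator (fun _ => (1 : ℝ)) u‖ₑ) :=
          lintegral_mono fun u => enorm_sub_le
      _ = 2 * volume (ball (0 : E) R) := by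
          rw [lintegral_add_right _ hχm.enorm,
            lintegral_add_right_eq_self
              (fun u => ‖(ball (0 : E) R).indicator (fun _ => (1 : ℝ)) u‖ₑ) z, hone, two_mul]
      _ = ENNReal.ofReal 2 * volume (ball (0 : E) R) := by rw [ENNReal.ofReal_ofNat]
  · have hr : ‖z‖ ≤ R := by
      rw [div_lt_iff₀ hR] at hle
      linarith [norm_nonneg z]
    haveI : Nontrivial E := Module.nontrivial_of_finrank_pos (R := ℝ) (by rw [hd]; norm_num)
    have hball : ∀ ρ : ℝ, 0 ≤ ρ →
        volume (ball (0 : E) ρ) = ENNReal.ofReal (ρ ^ 3) * volume (ball (0 : E) 1) := by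
      intro ρ hρ
      rw [Measure.addHaar_ball volume 0 hρ, hd]
    calc ∫⁻ u, ‖(ball (0 : E) R).indicator (fun _ => (1 : ℝ)) (u + z) -
            (ball (0 : E) R).indicator (fun _ => (1 : ℝ)) u‖ₑ
        ≤ ∫⁻ u, (ball (0 : E) (R + ‖z‖) \ ball 0 (R - ‖z‖)).indicator 1 u :=
          lintegral_mono fun u => enorm_indicator_ball_add_sub_le R z u
      _ = volume (ball (0 : E) (R + ‖z‖)) - volume (ball (0 : E) (R - ‖z‖)) := by
          rw [lintegral_indicator_one (measurableSet_ball.diff measurableSet_ball),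
            measure_sdiff (ball_subset_ball (by linarith [norm_nonneg z]))
              measurableSet_ball.nullMeasurableSet measure_ball_lt_top.ne]
      _ ≤ ENNReal.ofReal (8 * ‖z‖ / R) * volume (ball (0 : E) R) := by
          rw [hball (R + ‖z‖) (by positivity), hball (R - ‖z‖) (by linarith), hball R hR.le,
            tsub_le_iff_right,
            ← mul_assoc, ← ENNReal.ofReal_mul (by positivity), ← add_mul,
            ← ENNReal.ofReal_add (by positivity) (by positivity)]
          gcongr
          have h8 : 8 * ‖z‖ / R * R ^ 3 = 8 * ‖z‖ * R ^ 2 := by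
            field_simp
          rw [h8]
          nlinarith [mul_nonneg (mul_nonneg (norm_nonneg z) (sub_nonneg.2 hr))
            (add_nonneg hR.le (norm_nonneg z))]

/-- `min(2, c/R) → 0` as `R → ∞`. [folklore] -/
theorem tendsto_min_two_const_div_atTop (c : ℝ) :
    Tendsto (fun R : ℝ => min 2 (c / R)) atTop (𝓝 0) := by
  have h : Tendsto (fun R : ℝ => c / R) atTop (𝓝 0) := tendsto_const_nhds.div_atTop tendsto_id
  have h2 := (tendsto_const_nhds (x := (2 : ℝ))).min h
  rwa [min_eq_right (zero_le_two (α := ℝ))] at h2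

/-- From an `ℝ≥0∞` bound `‖∫_{B_R} f‖ₑ ≤ c |B_R| L` to the real bound `‖⨍_{B_R} f‖ ≤ c L` on the
ball average (`R > 0`, `L < ∞`). [folklore] -/
theorem norm_setAverage_ball_le_of_enorm_le {R : ℝ} (hR : 0 < R) (f : E → E) {c : ℝ} (hc : 0 ≤ c)
    {L : ℝ≥0∞} (hL : L ≠ ∞)
    (h : ‖∫ x in ball (0 : E) R, f x‖ₑ ≤ ENNReal.ofReal c * volume (ball (0 : E) R) * L) :
    ‖⨍ x in ball (0 : E) R, f x‖ ≤ c * L.toReal := by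
  have hv0 : 0 < (volume (ball (0 : E) R)).toReal :=
    ENNReal.toReal_pos (measure_ball_pos volume (0 : E) hR).ne' measure_ball_lt_top.ne
  have h' := ENNReal.toReal_mono
    (ENNReal.mul_ne_top (ENNReal.mul_ne_top ENNReal.ofReal_ne_top measure_ball_lt_top.ne) hL) h
  rw [← ofReal_norm, ENNReal.toReal_ofReal (norm_nonneg _), ENNReal.toReal_mul,
    ENNReal.toReal_mul, ENNReal.toReal_ofReal hc] at h'
  rw [setAverage_eq, norm_smul, norm_inv, measureReal_def, Real.norm_of_nonneg hv0.le]
  calc (volume (ball (0 : E) R)).toReal⁻¹ * ‖∫ x in ball (0 : E) R, f x‖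
      ≤ (volume (ball (0 : E) R)).toReal⁻¹ * (c * (volume (ball (0 : E) R)).toReal * L.toReal) :=
        by gcongr
    _ = c * L.toReal := by field_simp

/-! ### Translates of a bounded function have almost the same ball integrals -/

/-- For `‖w‖ ≤ M` measurable and `R > 0`:
`‖∫_{B_R} (w(x − z) − w(x)) dx‖ ≤ M · min(2, 8‖z‖/R) |B_R|` (dimension `3`). [folklore] -/
theorem enorm_setIntegral_ball_comp_sub_sub_le (hd : Module.finrank ℝ E = 3) {w : E → E}
    (hw : Measurable w) {M : ℝ} (hM : ∀ x, ‖w x‖ ≤ M) {R : ℝ} (hR : 0 < R) (z : E) :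
    ‖∫ x in ball (0 : E) R, (w (x - z) - w x)‖ₑ ≤
      ENNReal.ofReal M * (ENNReal.ofReal (min 2 (8 * ‖z‖ / R)) * volume (ball (0 : E) R)) := by
  set χ : E → ℝ := (ball (0 : E) R).indicator (fun _ => (1 : ℝ)) with hχ
  have hint : ∀ v : E, IntegrableOn (fun x => w (x - v)) (ball (0 : E) R) volume := fun v =>
    Measure.integrableOn_of_bounded measure_ball_lt_top.ne
      (hw.comp (measurable_id.sub_const v)).aestronglyMeasurable (ae_of_all _ fun x => hM _)
  have hint0 : IntegrableOn w (ball (0 : E) R) volume := by simpa using hint 0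
  have hind : ∀ f : E → E, (fun x => χ x • f x) = (ball (0 : E) R).indicator f := by
    intro f
    funext x
    by_cases hx : x ∈ ball (0 : E) R <;> simp [hχ, hx]
  have h1 : Integrable (fun x => χ x • w (x - z)) volume := by
    rw [hind (fun x => w (x - z))]
    exact (hint z).integrable_indicator measurableSet_ball
  have h1' : Integrable (fun x => χ x • w x) volume := by
    rw [hind w]
    exact hint0.integrable_indicator measurableSet_ball
  have h2 : Integrable (fun u => χ (u + z) • w u) volume := by
    have := h1.comp_add_right z
    simpa using this
  have hA : ∫ x in ball (0 : E) R, w (x - z) = ∫ u, χ (u + z) • w u := by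
    rw [← integral_indicator measurableSet_ball, ← hind (fun x => w (x - z)),
      ← integral_add_right_eq_self _ z]
    simp
  have hB : ∫ x in ball (0 : E) R, w x = ∫ u, χ u • w u := by
    rw [← integral_indicator measurableSet_ball, ← hind w]
  have h0 : ∫ x in ball (0 : E) R, (w (x - z) - w x) = ∫ u, (χ (u + z) - χ u) • w u := by
    rw [integral_sub (hint z) hint0, hA, hB, ← integral_sub h2 h1']
    simp_rw [sub_smul]
  rw [h0]
  calc ‖∫ u, (χ (u + z) - χ u) • w u‖ₑ ≤ ∫⁻ u, ‖(χ (u + z) - χ u) • w u‖ₑ :=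
        enorm_integral_le_lintegral_enorm _
    _ ≤ ∫⁻ u, ‖χ (u + z) - χ u‖ₑ * ENNReal.ofReal M := lintegral_mono fun u => by
        rw [enorm_smul]
        gcongr
        rw [← ofReal_norm]
        exact ENNReal.ofReal_le_ofReal (hM u)
    _ ≤ ENNReal.ofReal M * (ENNReal.ofReal (min 2 (8 * ‖z‖ / R)) * volume (ball (0 : E) R)) := by
        rw [lintegral_mul_const' _ _ ENNReal.ofReal_ne_top, mul_comm]
        gcongr
        exact lintegral_enorm_indicator_ball_add_sub_le hd hR z

/-! ### The heat part -/

/-- **Ball averages of the caloric increment of bounded data vanish at infinity**: for `g`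
measurable with `‖g‖ ≤ M` and `τ > 0`, `⨍_{B_R} (e^{τΔ}g − g) → 0` as `R → ∞` (dimension `3`):
by Fubini `∫_{B_R} (e^{τΔ}g − g) = ∫ Φ_τ(y) ∫_{B_R} (g(· − y) − g) dy` (`∫ Φ_τ = 1`), and dominated
convergence with `enorm_setIntegral_ball_comp_sub_sub_le`. [folklore] -/
theorem tendsto_setAverage_heatExtension_sub (hd : Module.finrank ℝ E = 3) {g : E → E}
    (hg : Measurable g) {M : ℝ} (hM : ∀ x, ‖g x‖ ≤ M) {τ : ℝ} (hτ : 0 < τ) :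
    Tendsto (fun R : ℝ => ⨍ x in ball (0 : E) R,
      (UnboundedOperators.heatExtension g τ x - g x)) atTop (𝓝 0) := by
  have hΦi : Integrable (UnboundedOperators.heatKernel (E := E) τ) :=
    UnboundedOperators.integrable_heatKernel_holds hτ
  have hΦ1 : ∫ y, UnboundedOperators.heatKernel (E := E) τ y = 1 :=
    UnboundedOperators.integral_heatKernel_eq_one_holds hτ
  have hΦ0 : ∀ y : E, 0 ≤ UnboundedOperators.heatKernel τ y := fun y =>
    (UnboundedOperators.heatKernel_pos hτ y).le
  have hΦc : Continuous (UnboundedOperators.heatKernel (E := E) τ) :=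
    UnboundedOperators.continuous_heatKernel τ
  have hM0 : 0 ≤ M := (norm_nonneg _).trans (hM 0)
  have hlΦ : ∫⁻ y, ENNReal.ofReal (UnboundedOperators.heatKernel (E := E) τ y) = 1 := by
    rw [← ofReal_integral_eq_lintegral_ofReal hΦi (ae_of_all _ hΦ0), hΦ1, ENNReal.ofReal_one]
  have hlΦ2 : ∫⁻ y : E, ENNReal.ofReal (UnboundedOperators.heatKernel τ y) * 2 ≠ ∞ := by
    rw [lintegral_mul_const' _ _ ENNReal.ofNat_ne_top, hlΦ, one_mul]
    exact ENNReal.ofNat_ne_top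
  have h2 : ∀ (R : ℝ) (y : E), ENNReal.ofReal (min 2 (8 * ‖y‖ / R)) ≤ 2 := fun R y =>
    (ENNReal.ofReal_le_ofReal (min_le_left _ _)).trans_eq (ENNReal.ofReal_ofNat 2)
  -- the bound for `R > 0`
  have key : ∀ R : ℝ, 0 < R →
      ‖⨍ x in ball (0 : E) R, (UnboundedOperators.heatExtension g τ x - g x)‖ ≤
        M * (∫⁻ y : E, ENNReal.ofReal (UnboundedOperators.heatKernel τ y) *
          ENNReal.ofReal (min 2 (8 * ‖y‖ / R))).toReal := by
    intro R hR
    haveI : IsFiniteMeasure ((volume : Measure E).restrict (ball (0 : E) R)) :=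
      isFiniteMeasure_restrict.2 measure_ball_lt_top.ne
    have hgi : ∀ v : E, IntegrableOn (fun x => g (x - v)) (ball (0 : E) R) volume := fun v =>
      Measure.integrableOn_of_bounded measure_ball_lt_top.ne
        (hg.comp (measurable_id.sub_const v)).aestronglyMeasurable (ae_of_all _ fun x => hM _)
    have hgi0 : IntegrableOn g (ball (0 : E) R) volume := by simpa using hgi 0
    -- Fubini for `(x, y) ↦ Φ(y) • g(x - y)` on `B_R × E`
    have hF : Integrable (uncurry fun (x y : E) => UnboundedOperators.heatKernel τ y • g (x - y))
        (((volume : Measure E).restrict (ball (0 : E) R)).prod volume) := by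
      refine Integrable.mono' ((integrable_const M).mul_prod hΦi)
        ((hΦc.measurable.comp measurable_snd).smul
          (hg.comp (measurable_fst.sub measurable_snd))).aestronglyMeasurable
        (ae_of_all _ fun q => ?_)
      rcases q with ⟨x, y⟩
      simp only [uncurry_apply_pair, norm_smul, Real.norm_of_nonneg (hΦ0 _)]
      rw [mul_comm]
      exact mul_le_mul_of_nonneg_right (hM _) (hΦ0 y)
    have hswap : ∫ x in ball (0 : E) R, UnboundedOperators.heatExtension g τ x =
        ∫ y, UnboundedOperators.heatKernel τ y • ∫ x in ball (0 : E) R, g (x - y) := by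
      simp_rw [UnboundedOperators.heatExtension_apply]
      rw [integral_integral_swap hF]
      simp_rw [integral_smul]
    have hI1 : Integrable (fun y => UnboundedOperators.heatKernel τ y •
        ∫ x in ball (0 : E) R, g (x - y)) volume := by
      simpa [integral_smul] using hF.integral_prod_right
    have hAi : Integrable (fun x => UnboundedOperators.heatExtension g τ x)
        ((volume : Measure E).restrict (ball (0 : E) R)) := by
      simpa [UnboundedOperators.heatExtension_apply] using hF.integral_prod_left
    have hg1 : ∫ x in ball (0 : E) R, g x =
        ∫ y : E, UnboundedOperators.heatKernel τ y • ∫ x in ball (0 : E) R, g x := by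
      rw [integral_smul_const, hΦ1, one_smul]
    have hdiff : ∫ x in ball (0 : E) R, (UnboundedOperators.heatExtension g τ x - g x) =
        ∫ y, UnboundedOperators.heatKernel τ y • ∫ x in ball (0 : E) R, (g (x - y) - g x) := by
      rw [integral_sub hAi hgi0, hswap, hg1, ← integral_sub hI1 (hΦi.smul_const _)]
      refine integral_congr_ae (ae_of_all _ fun y => ?_)
      dsimp only
      rw [← smul_sub, integral_sub (hgi y) hgi0]
    -- the `ℝ≥0∞` bound
    have hmain : ‖∫ x in ball (0 : E) R, (UnboundedOperators.heatExtension g τ x - g x)‖ₑ ≤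
        ENNReal.ofReal M * volume (ball (0 : E) R) *
          ∫⁻ y : E, ENNReal.ofReal (UnboundedOperators.heatKernel τ y) *
            ENNReal.ofReal (min 2 (8 * ‖y‖ / R)) := by
      rw [hdiff]
      calc ‖∫ y, UnboundedOperators.heatKernel τ y • ∫ x in ball (0 : E) R, (g (x - y) - g x)‖ₑ
          ≤ ∫⁻ y, ‖UnboundedOperators.heatKernel τ y • ∫ x in ball (0 : E) R, (g (x - y) - g x)‖ₑ :=
            enorm_integral_le_lintegral_enorm _
        _ ≤ ∫⁻ y : E, ENNReal.ofReal (UnboundedOperators.heatKernel τ y) * (ENNReal.ofReal M *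
              (ENNReal.ofReal (min 2 (8 * ‖y‖ / R)) * volume (ball (0 : E) R))) :=
            lintegral_mono fun y => by
              rw [enorm_smul, Real.enorm_eq_ofReal (hΦ0 y)]
              gcongr
              exact enorm_setIntegral_ball_comp_sub_sub_le hd hg hM hR y
        _ = _ := by
            rw [← lintegral_const_mul' _ _
              (ENNReal.mul_ne_top ENNReal.ofReal_ne_top measure_ball_lt_top.ne)]
            congr 1
            funext y
            ring
    have hLfin : ∫⁻ y : E, ENNReal.ofReal (UnboundedOperators.heatKernel τ y) *
        ENNReal.ofReal (min 2 (8 * ‖y‖ / R)) ≠ ∞ :=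
      ne_top_of_le_ne_top hlΦ2 (lintegral_mono fun y => by gcongr; exact h2 R y)
    exact norm_setAverage_ball_le_of_enorm_le hR _ hM0 hLfin hmain
  -- dominated convergence
  have hL : Tendsto (fun R : ℝ => ∫⁻ y : E, ENNReal.ofReal (UnboundedOperators.heatKernel τ y) *
      ENNReal.ofReal (min 2 (8 * ‖y‖ / R))) atTop (𝓝 0) := by
    have h := tendsto_lintegral_filter_of_dominated_convergence
      (μ := (volume : Measure E)) (l := atTop)
      (F := fun (R : ℝ) (y : E) => ENNReal.ofReal (UnboundedOperators.heatKernel τ y) *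
        ENNReal.ofReal (min 2 (8 * ‖y‖ / R)))
      (f := fun _ => 0) (fun y => ENNReal.ofReal (UnboundedOperators.heatKernel τ y) * 2)
      ?_ ?_ hlΦ2 ?_
    · simpa using h
    · exact Eventually.of_forall fun R => by fun_prop
    · exact Eventually.of_forall fun R => ae_of_all _ fun y => by gcongr; exact h2 R y
    · exact ae_of_all _ fun y => by
        simpa using ENNReal.Tendsto.const_mul (ENNReal.tendsto_ofReal
          (tendsto_min_two_const_div_atTop (8 * ‖y‖))) (Or.inr ENNReal.ofReal_ne_top)
  refine squeeze_zero_norm' ((eventually_gt_atTop (0 : ℝ)).mono fun R hR => key R hR) ?_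
  have h := ((ENNReal.tendsto_toReal ENNReal.zero_ne_top).comp hL).const_mul M
  simpa using h

/-! ### The Oseen part -/

/-- **The ball integral of a translate of the Oseen kernel.** Since `∫ K(σ, ·)[a,b] = 0`
(`integral_oseenKernel_eq_zero`),
`∫_{x∈B_R} K(σ, x−y)[a,b] dx = ∫ (χ_R(x) − χ_R(y)) K(σ, x−y)[a,b] dx` with `χ_R = 1_{B_R}`, whence,
under Koch–Tataru's bound (14) in the form `‖K(σ,z)[a,b]‖ ≤ C (σ + ‖z‖²)^{-2} ‖a‖‖b‖`,
`‖∫_{x∈B_R} K(σ, x−y)[a,b] dx‖ ≤ C‖a‖‖b‖ ∫ |χ_R(z+y) − χ_R(y)| (σ + ‖z‖²)^{-2} dz`.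
[cite: KochTataruAdvMath2001, §3 (14)] -/
theorem enorm_setIntegral_oseenKernel_le {C : ℝ}
    (hK : ∀ {σ : ℝ}, 0 < σ → ∀ z a b : E,
      ‖oseenKernel σ z a b‖ ≤ C * (σ + ‖z‖ ^ 2) ^ (-2 : ℝ) * ‖a‖ * ‖b‖)
    {σ : ℝ} (hσ : 0 < σ) (y a b : E) (R : ℝ) :
    ‖∫ x in ball (0 : E) R, oseenKernel σ (x - y) a b‖ₑ ≤
      ENNReal.ofReal (C * ‖a‖ * ‖b‖) *
        ∫⁻ z, ‖(ball (0 : E) R).indicator (fun _ => (1 : ℝ)) (z + y) -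
            (ball (0 : E) R).indicator (fun _ => (1 : ℝ)) y‖ₑ *
          ENNReal.ofReal ((σ + ‖z‖ ^ 2) ^ (-2 : ℝ)) := by
  set χ : E → ℝ := (ball (0 : E) R).indicator (fun _ => (1 : ℝ)) with hχ
  obtain ⟨C₂, -, hL1⟩ := exists_lintegral_enorm_oseenKernel_le (E := E)
  have hk : Integrable (fun x => oseenKernel σ (x - y) a b) volume :=
    (hL1 hσ a b).1.comp_sub_right y
  have hzero : ∫ x, oseenKernel σ (x - y) a b = 0 := by
    rw [integral_sub_right_eq_self (fun z => oseenKernel σ z a b) y]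
    exact integral_oseenKernel_eq_zero σ a b
  have hind : (fun x => χ x • oseenKernel σ (x - y) a b) =
      (ball (0 : E) R).indicator (fun x => oseenKernel σ (x - y) a b) := by
    funext x
    by_cases hx : x ∈ ball (0 : E) R <;> simp [hχ, hx]
  have h1 : Integrable (fun x => χ x • oseenKernel σ (x - y) a b) volume := by
    rw [hind]
    exact hk.indicator measurableSet_ball
  have hrepr : ∫ x in ball (0 : E) R, oseenKernel σ (x - y) a b =
      ∫ x, (χ x - χ y) • oseenKernel σ (x - y) a b := by
    have h2 : Integrable (fun x => χ y • oseenKernel σ (x - y) a b) volume := hk.smul (χ y)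
    simp_rw [sub_smul]
    rw [integral_sub h1 h2, integral_smul, hzero, smul_zero, sub_zero,
      ← integral_indicator measurableSet_ball, ← hind]
  rw [hrepr]
  calc ‖∫ x, (χ x - χ y) • oseenKernel σ (x - y) a b‖ₑ
      ≤ ∫⁻ x, ‖(χ x - χ y) • oseenKernel σ (x - y) a b‖ₑ := enorm_integral_le_lintegral_enorm _
    _ ≤ ∫⁻ x, ‖χ x - χ y‖ₑ * (ENNReal.ofReal (C * ‖a‖ * ‖b‖) *
          ENNReal.ofReal ((σ + ‖x - y‖ ^ 2) ^ (-2 : ℝ))) :=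
        lintegral_mono fun x => by
          rw [enorm_smul, ← ENNReal.ofReal_mul' (Real.rpow_nonneg (by positivity) _)]
          gcongr
          rw [← ofReal_norm]
          refine ENNReal.ofReal_le_ofReal ?_
          calc ‖oseenKernel σ (x - y) a b‖
              ≤ C * (σ + ‖x - y‖ ^ 2) ^ (-2 : ℝ) * ‖a‖ * ‖b‖ := hK hσ _ a b
            _ = C * ‖a‖ * ‖b‖ * (σ + ‖x - y‖ ^ 2) ^ (-2 : ℝ) := by ring
    _ = ENNReal.ofReal (C * ‖a‖ * ‖b‖) *
          ∫⁻ x, ‖χ x - χ y‖ₑ * ENNReal.ofReal ((σ + ‖x - y‖ ^ 2) ^ (-2 : ℝ)) := by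
        rw [← lintegral_const_mul' _ _ ENNReal.ofReal_ne_top]
        congr 1
        funext x
        ring
    _ = _ := by
        congr 1
        rw [← lintegral_add_right_eq_self _ y]
        simp only [add_sub_cancel_right]

/-- **Tonelli in `(y, z)` and the translation modulus**: for `R > 0` (dimension `3`) and the
weight `w(z) = (σ + ‖z‖²)^{-2}`,
`∫_y ∫_z |χ_R(z+y) − χ_R(y)| w(z) dz dy ≤ |B_R| ∫_z w(z) min(2, 8‖z‖/R) dz`. [folklore] -/
theorem lintegral_lintegral_indicator_weight_le (hd : Module.finrank ℝ E = 3) {R : ℝ}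
    (hR : 0 < R) (σ : ℝ) :
    ∫⁻ y, ∫⁻ z, ‖(ball (0 : E) R).indicator (fun _ => (1 : ℝ)) (z + y) -
          (ball (0 : E) R).indicator (fun _ => (1 : ℝ)) y‖ₑ *
        ENNReal.ofReal ((σ + ‖z‖ ^ 2) ^ (-2 : ℝ)) ≤
      volume (ball (0 : E) R) * ∫⁻ z : E, ENNReal.ofReal ((σ + ‖z‖ ^ 2) ^ (-2 : ℝ)) *
        ENNReal.ofReal (min 2 (8 * ‖z‖ / R)) := by
  set χ : E → ℝ := (ball (0 : E) R).indicator (fun _ => (1 : ℝ)) with hχ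
  have hm : Measurable fun q : E × E =>
      ‖χ (q.2 + q.1) - χ q.1‖ₑ * ENNReal.ofReal ((σ + ‖q.2‖ ^ 2) ^ (-2 : ℝ)) := by
    rw [hχ]
    fun_prop (disch := exact measurableSet_ball)
  rw [lintegral_lintegral_swap
      (f := fun y z => ‖χ (z + y) - χ y‖ₑ * ENNReal.ofReal ((σ + ‖z‖ ^ 2) ^ (-2 : ℝ)))
      hm.aemeasurable,
    ← lintegral_const_mul' _ _ measure_ball_lt_top.ne]
  refine lintegral_mono fun z => ?_
  rw [lintegral_mul_const' _ _ ENNReal.ofReal_ne_top]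
  calc (∫⁻ y, ‖χ (z + y) - χ y‖ₑ) * ENNReal.ofReal ((σ + ‖z‖ ^ 2) ^ (-2 : ℝ))
      ≤ (ENNReal.ofReal (min 2 (8 * ‖z‖ / R)) * volume (ball (0 : E) R)) *
          ENNReal.ofReal ((σ + ‖z‖ ^ 2) ^ (-2 : ℝ)) := by
        gcongr
        simp_rw [add_comm z]
        exact lintegral_enorm_indicator_ball_add_sub_le hd hR z
    _ = _ := by ring

/-- **The time-integrated weight is finite**: with `I = ∫ (1 + ‖w‖²)^{-2} dw`,
`∫_{(s,t)} ∫ ((t−τ) + ‖z‖²)^{-2} · 2 dz dτ = 2√(t−s) · (2 I)` (parabolic scaling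
`∫ (σ + ‖z‖²)^{-2} dz = σ^{-1/2} I` in dimension `3`, `lintegral_add_norm_sq_rpow_neg`).
[folklore] -/
theorem lintegral_Ioo_lintegral_weight (hd : Module.finrank ℝ E = 3) {s t : ℝ} (hst : s < t) :
    ∫⁻ τ in Ioo s t, ∫⁻ z : E, ENNReal.ofReal (((t - τ) + ‖z‖ ^ 2) ^ (-2 : ℝ)) * 2 =
      ENNReal.ofReal (2 * Real.sqrt (t - s)) *
        (ENNReal.ofReal (∫ w : E, (1 + ‖w‖ ^ 2) ^ (-2 : ℝ)) * 2) := by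
  have he : (Module.finrank ℝ E : ℝ) < 2 * 2 := by rw [hd]; norm_num
  have h32 : (Module.finrank ℝ E : ℝ) / 2 - 2 = -(1 / 2 : ℝ) := by rw [hd]; norm_num
  rw [← setLIntegral_Ioo_sub_rpow_neg_half_of_lt hst,
    ← lintegral_mul_const' _ _ (ENNReal.mul_ne_top ENNReal.ofReal_ne_top ENNReal.ofNat_ne_top)]
  refine setLIntegral_congr_fun measurableSet_Ioo fun τ hτ => ?_
  rw [lintegral_mul_const' _ _ ENNReal.ofNat_ne_top,
    lintegral_add_norm_sq_rpow_neg he (sub_pos.2 hτ.2), h32,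
    ENNReal.ofReal_mul (Real.rpow_nonneg (sub_pos.2 hτ.2).le _), mul_assoc]

/-- **Dominated convergence for the time-integrated weight against the translation modulus**:
`∫_{(s,t)} ∫ ((t−τ) + ‖z‖²)^{-2} min(2, 8‖z‖/R) dz dτ → 0` as `R → ∞` (dimension `3`). [folklore] -/
theorem tendsto_lintegral_Ioo_lintegral_weight (hd : Module.finrank ℝ E = 3) {s t : ℝ}
    (hst : s < t) :
    Tendsto (fun R : ℝ => ∫⁻ τ in Ioo s t, ∫⁻ z : E,
      ENNReal.ofReal (((t - τ) + ‖z‖ ^ 2) ^ (-2 : ℝ)) * ENNReal.ofReal (min 2 (8 * ‖z‖ / R)))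
      atTop (𝓝 0) := by
  have he : (Module.finrank ℝ E : ℝ) < 2 * 2 := by rw [hd]; norm_num
  have h2 : ∀ (R : ℝ) (z : E), ENNReal.ofReal (min 2 (8 * ‖z‖ / R)) ≤ 2 := fun R z =>
    (ENNReal.ofReal_le_ofReal (min_le_left _ _)).trans_eq (ENNReal.ofReal_ofNat 2)
  have hmeas : ∀ R : ℝ, Measurable fun q : ℝ × E =>
      ENNReal.ofReal (((t - q.1) + ‖q.2‖ ^ 2) ^ (-2 : ℝ)) *
        ENNReal.ofReal (min 2 (8 * ‖q.2‖ / R)) := fun R => by fun_prop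
  have hlim : ∀ (σ : ℝ) (z : E), Tendsto (fun R : ℝ => ENNReal.ofReal ((σ + ‖z‖ ^ 2) ^ (-2 : ℝ)) *
      ENNReal.ofReal (min 2 (8 * ‖z‖ / R))) atTop (𝓝 0) := fun σ z => by
    simpa using ENNReal.Tendsto.const_mul (ENNReal.tendsto_ofReal
      (tendsto_min_two_const_div_atTop (8 * ‖z‖))) (Or.inr ENNReal.ofReal_ne_top)
  have h := tendsto_lintegral_filter_of_dominated_convergence
    (μ := (volume : Measure ℝ).restrict (Ioo s t)) (l := atTop)
    (F := fun (R : ℝ) (τ : ℝ) => ∫⁻ z : E, ENNReal.ofReal (((t - τ) + ‖z‖ ^ 2) ^ (-2 : ℝ)) *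
      ENNReal.ofReal (min 2 (8 * ‖z‖ / R)))
    (f := fun _ => 0) (fun τ => ∫⁻ z : E, ENNReal.ofReal (((t - τ) + ‖z‖ ^ 2) ^ (-2 : ℝ)) * 2)
    ?_ ?_ ?_ ?_
  · simpa using h
  · exact Eventually.of_forall fun R => (hmeas R).lintegral_prod_right'
  · exact Eventually.of_forall fun R => ae_of_all _ fun τ =>
      lintegral_mono fun z => by gcongr; exact h2 R z
  · rw [lintegral_Ioo_lintegral_weight hd hst]
    exact ENNReal.mul_ne_top ENNReal.ofReal_ne_top
      (ENNReal.mul_ne_top ENNReal.ofReal_ne_top ENNReal.ofNat_ne_top)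
  · refine (ae_restrict_iff' measurableSet_Ioo).2 (ae_of_all _ fun τ hτ => ?_)
    have hσ : 0 < t - τ := sub_pos.2 hτ.2
    have h' := tendsto_lintegral_filter_of_dominated_convergence
      (μ := (volume : Measure E)) (l := atTop)
      (F := fun (R : ℝ) (z : E) => ENNReal.ofReal (((t - τ) + ‖z‖ ^ 2) ^ (-2 : ℝ)) *
        ENNReal.ofReal (min 2 (8 * ‖z‖ / R)))
      (f := fun _ => 0) (fun z => ENNReal.ofReal (((t - τ) + ‖z‖ ^ 2) ^ (-2 : ℝ)) * 2)
      ?_ ?_ ?_ (ae_of_all _ fun z => hlim (t - τ) z)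
    · simpa using h'
    · exact Eventually.of_forall fun R => by fun_prop
    · exact Eventually.of_forall fun R => ae_of_all _ fun z => by gcongr; exact h2 R z
    · rw [lintegral_mul_const' _ _ ENNReal.ofNat_ne_top, lintegral_add_norm_sq_rpow_neg he hσ]
      exact ENNReal.mul_ne_top ENNReal.ofReal_ne_top ENNReal.ofNat_ne_top

/-- **Ball averages of the Oseen–Duhamel term of a bounded field vanish at infinity**: for `V`
jointly measurable and bounded by `N` on `[s, t] × E` (`s < t`, dimension `3`),
`⨍_{B_R} B¹_s(V,V)(t) → 0` as `R → ∞` (Fubini over `B_R × ((s,t) × E)`,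
`enorm_setIntegral_oseenKernel_le`, Tonelli, and dominated convergence in time against
`(t − τ)^{-1/2}`; KNSS 2009, §4: `B` does not see constants). [cite: KochNadirashviliSereginSverak2009, §4 p. 8 (the bilinear form B) (arXiv:0709.3599)] -/
theorem tendsto_setAverage_oseenDuhamel (hd : Module.finrank ℝ E = 3)
    {V : ℝ → E → E} (hV : Measurable (uncurry V)) {N s t : ℝ} (hst : s < t)
    (hN : ∀ σ ∈ Icc s t, ∀ y, ‖V σ y‖ ≤ N) :
    Tendsto (fun R : ℝ => ⨍ x in ball (0 : E) R, oseenDuhamel 1 s V V t x) atTop (𝓝 0) := by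
  obtain ⟨C₀, hC₀, hK⟩ := exists_norm_oseenKernel_le (E := E)
  have hexp : -((((Module.finrank ℝ E : ℝ)) + 1) / 2) = (-2 : ℝ) := by rw [hd]; norm_num
  have hK' : ∀ {σ : ℝ}, 0 < σ → ∀ z a b : E,
      ‖oseenKernel σ z a b‖ ≤ C₀ * (σ + ‖z‖ ^ 2) ^ (-2 : ℝ) * ‖a‖ * ‖b‖ := by
    intro σ hσ z a b
    have h := hK hσ z a b
    rw [hexp] at h
    exact h
  obtain ⟨C₁, -, hB⟩ := exists_lintegral_enorm_oseenKernel_bounded_le (E := E)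
  have hN0 : 0 ≤ N := (norm_nonneg _).trans (hN s (left_mem_Icc.2 hst.le) 0)
  have hNo : ∀ τ ∈ Ioo s t, ∀ y, ‖V τ y‖ ≤ N := fun τ hτ y => hN τ (Ioo_subset_Icc_self hτ) y
  have hVm : AEStronglyMeasurable (uncurry V)
      ((volume : Measure (ℝ × E)).restrict (Ioo s t ×ˢ univ)) := hV.aestronglyMeasurable
  have hprod : ∀ x, oseenDuhamel 1 s V V t x = ∫ p in Ioo s t ×ˢ (univ : Set E),
      oseenKernel (t - p.1) (x - p.2) (V p.1 p.2) (V p.1 p.2) := by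
    intro x
    have h := oseenDuhamel_eq_integral_prod one_pos hVm hVm hN0 hNo hNo hst le_rfl x
    simpa only [one_mul] using h
  have hB1 : ∀ x, ∫⁻ τ in Ioo s t, ∫⁻ y, ‖oseenKernel (t - τ) (x - y) (V τ y) (V τ y)‖ₑ ≤
      ENNReal.ofReal (C₁ * N ^ 2 * (2 * Real.sqrt (t - s))) := by
    intro x
    have h := hB one_pos hst hN0 hNo hNo x
    simpa only [one_mul, Real.one_rpow, mul_one] using h
  -- the bound for `R > 0`
  have key : ∀ R : ℝ, 0 < R → ‖⨍ x in ball (0 : E) R, oseenDuhamel 1 s V V t x‖ ≤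
      C₀ * N ^ 2 * (∫⁻ τ in Ioo s t, ∫⁻ z : E, ENNReal.ofReal (((t - τ) + ‖z‖ ^ 2) ^ (-2 : ℝ)) *
        ENNReal.ofReal (min 2 (8 * ‖z‖ / R))).toReal := by
    intro R hR
    set χ : E → ℝ := (ball (0 : E) R).indicator (fun _ => (1 : ℝ)) with hχ
    -- absolute convergence on `B_R × ((s,t) × E)` and Fubini
    have hGi : Integrable (uncurry fun (x : E) (p : ℝ × E) =>
        oseenKernel (t - p.1) (x - p.2) (V p.1 p.2) (V p.1 p.2))
        (((volume : Measure E).restrict (ball (0 : E) R)).prod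
          ((volume : Measure (ℝ × E)).restrict (Ioo s t ×ˢ univ))) := by
      refine ⟨(Measurable.oseenKernel_comp (measurable_const.sub measurable_snd.fst)
        (measurable_fst.sub measurable_snd.snd) (hV.comp measurable_snd)
        (hV.comp measurable_snd)).aestronglyMeasurable, ?_⟩
      refine (lintegral_prod_le _).trans_lt ?_
      calc ∫⁻ x in ball (0 : E) R, ∫⁻ p in Ioo s t ×ˢ (univ : Set E),
            ‖oseenKernel (t - p.1) (x - p.2) (V p.1 p.2) (V p.1 p.2)‖ₑ
          ≤ ∫⁻ x in ball (0 : E) R, ENNReal.ofReal (C₁ * N ^ 2 * (2 * Real.sqrt (t - s))) :=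
            lintegral_mono fun x => by
              rw [volume_restrict_prod_univ_eq_prod]
              exact (lintegral_prod_le _).trans (hB1 x)
        _ < ∞ := by
            rw [lintegral_const, Measure.restrict_apply_univ]
            exact ENNReal.mul_lt_top ENNReal.ofReal_lt_top measure_ball_lt_top
    have hswap : ∫ x in ball (0 : E) R, oseenDuhamel 1 s V V t x =
        ∫ p in Ioo s t ×ˢ (univ : Set E), ∫ x in ball (0 : E) R,
          oseenKernel (t - p.1) (x - p.2) (V p.1 p.2) (V p.1 p.2) := by
      simp_rw [hprod]
      exact integral_integral_swap hGi
    -- the pointwise bound on the slab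
    have hpt : ∀ p ∈ Ioo s t ×ˢ (univ : Set E),
        ‖∫ x in ball (0 : E) R, oseenKernel (t - p.1) (x - p.2) (V p.1 p.2) (V p.1 p.2)‖ₑ ≤
          ENNReal.ofReal (C₀ * N ^ 2) * ∫⁻ z, ‖χ (z + p.2) - χ p.2‖ₑ *
            ENNReal.ofReal (((t - p.1) + ‖z‖ ^ 2) ^ (-2 : ℝ)) := by
      rintro ⟨τ, y⟩ ⟨hτ, -⟩
      refine (enorm_setIntegral_oseenKernel_le hK' (sub_pos.2 hτ.2) y _ _ R).trans ?_
      refine mul_le_mul' (ENNReal.ofReal_le_ofReal ?_) le_rfl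
      nlinarith [mul_nonneg hC₀.le (mul_nonneg (sub_nonneg.2 (hNo τ hτ y))
        (add_nonneg hN0 (norm_nonneg (V τ y))))]
    -- integrate it
    have hmain : ‖∫ x in ball (0 : E) R, oseenDuhamel 1 s V V t x‖ₑ ≤
        ENNReal.ofReal (C₀ * N ^ 2) * volume (ball (0 : E) R) *
          ∫⁻ τ in Ioo s t, ∫⁻ z : E, ENNReal.ofReal (((t - τ) + ‖z‖ ^ 2) ^ (-2 : ℝ)) *
            ENNReal.ofReal (min 2 (8 * ‖z‖ / R)) := by
      rw [hswap]
      calc ‖∫ p in Ioo s t ×ˢ (univ : Set E), ∫ x in ball (0 : E) R,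
              oseenKernel (t - p.1) (x - p.2) (V p.1 p.2) (V p.1 p.2)‖ₑ
          ≤ ∫⁻ p in Ioo s t ×ˢ (univ : Set E), ‖∫ x in ball (0 : E) R,
              oseenKernel (t - p.1) (x - p.2) (V p.1 p.2) (V p.1 p.2)‖ₑ :=
            enorm_integral_le_lintegral_enorm _
        _ ≤ ∫⁻ p in Ioo s t ×ˢ (univ : Set E), ENNReal.ofReal (C₀ * N ^ 2) *
              ∫⁻ z, ‖χ (z + p.2) - χ p.2‖ₑ * ENNReal.ofReal (((t - p.1) + ‖z‖ ^ 2) ^ (-2 : ℝ)) :=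
            setLIntegral_mono' (measurableSet_Ioo.prod MeasurableSet.univ) hpt
        _ ≤ ∫⁻ τ in Ioo s t, ∫⁻ y, ENNReal.ofReal (C₀ * N ^ 2) * ∫⁻ z, ‖χ (z + y) - χ y‖ₑ *
              ENNReal.ofReal (((t - τ) + ‖z‖ ^ 2) ^ (-2 : ℝ)) := by
            rw [volume_restrict_prod_univ_eq_prod]
            exact lintegral_prod_le _
        _ ≤ ∫⁻ τ in Ioo s t, ENNReal.ofReal (C₀ * N ^ 2) * (volume (ball (0 : E) R) *
              ∫⁻ z : E, ENNReal.ofReal (((t - τ) + ‖z‖ ^ 2) ^ (-2 : ℝ)) *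
                ENNReal.ofReal (min 2 (8 * ‖z‖ / R))) :=
            lintegral_mono fun τ => by
              rw [lintegral_const_mul' _ _ ENNReal.ofReal_ne_top]
              gcongr
              exact lintegral_lintegral_indicator_weight_le hd hR (t - τ)
        _ = _ := by
            rw [← lintegral_const_mul' _ _
              (ENNReal.mul_ne_top ENNReal.ofReal_ne_top measure_ball_lt_top.ne)]
            simp_rw [mul_assoc]
    have hJfin : ∫⁻ τ in Ioo s t, ∫⁻ z : E, ENNReal.ofReal (((t - τ) + ‖z‖ ^ 2) ^ (-2 : ℝ)) *
        ENNReal.ofReal (min 2 (8 * ‖z‖ / R)) ≠ ∞ := by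
      have hb : ∫⁻ τ in Ioo s t, ∫⁻ z : E,
          ENNReal.ofReal (((t - τ) + ‖z‖ ^ 2) ^ (-2 : ℝ)) * 2 ≠ ∞ := by
        rw [lintegral_Ioo_lintegral_weight hd hst]
        exact ENNReal.mul_ne_top ENNReal.ofReal_ne_top
          (ENNReal.mul_ne_top ENNReal.ofReal_ne_top ENNReal.ofNat_ne_top)
      refine ne_top_of_le_ne_top hb (lintegral_mono fun τ => lintegral_mono fun z => ?_)
      gcongr
      exact (ENNReal.ofReal_le_ofReal (min_le_left _ _)).trans_eq (ENNReal.ofReal_ofNat 2)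
    exact norm_setAverage_ball_le_of_enorm_le hR _ (by positivity) hJfin hmain
  refine squeeze_zero_norm' ((eventually_gt_atTop (0 : ℝ)).mono fun R hR => key R hR) ?_
  have h := ((ENNReal.tendsto_toReal ENNReal.zero_ne_top).comp
    (tendsto_lintegral_Ioo_lintegral_weight hd hst)).const_mul (C₀ * N ^ 2)
  simpa using h

end Literature.Analysis.FluidPDE

end
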